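import Literature.NumberTheory.LFunctions.SmoothedExplicitFormulaLeftLine
import Literature.NumberTheory.LFunctions.KadiriTestFunction
import HarnessLib

/-!
# Kadiri's bound for the `Γ`-remainder `T₂(s)` of the explicit formula (Acta Arith. 117 (2005), Lemma 4.7 / Prop. 2.4)

Topic `Literature/NumberTheory/LFunctions`. Everything in this file is PROVED (no named fact, no
definition). In Kadiri's Prop. 2.1 (tree: `SmoothedEF.re_fordK_eq_kadiri`) the `Γ`-factor
contributes, besides `f(0)(−½log π + ½ Re ψ(s/2+1))`, the remainder

  `T₂(s) = Re[ F₀(s) + (1/2π) ∫ Re ψ((1/2+iy)/2) · F₀(s − 1/2 − iy) dy ]`,  `F₀(z) = F(z) − f(0)/z`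

(Kadiri's `(1/2π)∫ Re Γ'/Γ(1/4 + iT/2) H(σ−1/2, t−T) dT + H(σ, t)`, `H = Re F₀`). Lemma 4.7 bounds it
for the test function `f = ηh(η·)` through Lemma 3.2 (`|Re F₀(x+iY)| ≤ M(x/η)η²/(x²+Y²)`) and
Fubini:

  `|T₂(σ+it)| ≤ M(σ/η)η²/(σ²+t²) + (M((σ−½)/η) η²/2π) ∫ |Re ψ(1/4 + iy/2)| dy/((σ−½)² + (t−y)²)`

(`σ > 1/2`), which with `M(z) ≤ m/z` (`KadiriBoundary.mtyM_le_div`) is her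
`C₄₀(η, σ−½, t) + |H(σ,t)|`, i.e. Mossinghoff–Trudgian's `η³ m [C₄₁ + C₄₂]` before the
evaluation of the `U₀`-integrals (left to the numerical stage; the crude growth bound
`|Re ψ((1/2+iy)/2)| ≤ log(3+|y|) + 12` proved here gives integrability, and the monotonicity of
`y ↦ Re ψ(1/4 + iy/2)` in `|y|` proved here is the tool for sharp piecewise bounds).

## References

* H. Kadiri, *Une région explicite sans zéros pour la fonction ζ de Riemann*, Acta Arith. 117
  (2005) = arXiv:math/0401238, Lemma 4.7 and its proof, (C41), (C42), Lemma 3.6. (`Kadiri2005`)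
* M. J. Mossinghoff, T. S. Trudgian, J. Number Theory 157 (2015) = arXiv:1410.3926, §4.4
  (`C₄(η) = η³ m Σ a_k (C₄₁(k) + C₄₂(k))`, the corrected `U₀`). (`MossinghoffTrudgian2015`)
-/

noncomputable section

open Complex Real MeasureTheory Set

namespace Literature.NumberTheory.LFunctions

namespace KadiriGamma

/-! ## The digamma factor on the line `Re w = 1/2` -/

/-- **Crude growth bound**: `|Re ψ((1/2 + iy)/2)| ≤ log(3 + |y|) + 12`. [folklore] -/
theorem abs_re_digamma_le (y : ℝ) :
    |(digamma (((((1 / 2 : ℝ)) : ℂ) + y * I) / 2)).re| ≤ Real.log (3 + |y|) + 12 := by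
  set w : ℂ := (((1 / 2 : ℝ)) : ℂ) + y * I with hw
  have hwre : w.re = 1 / 2 := by simp [hw]
  have hwim : w.im = y := by simp [hw]
  have h1 := SmoothedEF.kadiriP_sub_right_line y
  have h2 := SmoothedEF.norm_kadiriP_sub_le (w := w) (by rw [hwre]; norm_num) (by rw [hwre])
  obtain ⟨h3, h4⟩ := SmoothedEF.norm_inv_le_two_of_re (w := w) (Or.inl hwre)
  rw [← hw] at h1
  rw [h1, Complex.norm_real, Real.norm_eq_abs, hwim] at h2
  linarith

/-- **Monotonicity in `|y|`**: for `x > 0` and `0 ≤ y₁ ≤ y₂`, `Re ψ(x + iy₁) ≤ Re ψ(x + iy₂)`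
(termwise in `ψ(w) + γ = Σ (1/(k+1) − 1/(w+k))`: `Re 1/(w+k) = (x+k)/((x+k)² + y²)` decreases in
`|y|`). [folklore] -/
theorem re_digamma_mono_im {x y₁ y₂ : ℝ} (hx : 0 < x) (hy₁ : 0 ≤ y₁) (hy : y₁ ≤ y₂) :
    (digamma ((x : ℂ) + y₁ * I)).re ≤ (digamma ((x : ℂ) + y₂ * I)).re := by
  have hA := (Literature.Analysis.SpecialFunctions.Complex.hasSum_one_div_sub_one_div_digamma
    (w := (x : ℂ) + y₁ * I) (by simp [hx])).mapL Complex.reCLM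
  have hB := (Literature.Analysis.SpecialFunctions.Complex.hasSum_one_div_sub_one_div_digamma
    (w := (x : ℂ) + y₂ * I) (by simp [hx])).mapL Complex.reCLM
  simp only [Complex.reCLM_apply, Complex.add_re] at hA hB
  have hre : ∀ (y : ℝ) (k : ℕ), (1 / ((k : ℂ) + 1) - 1 / ((x : ℂ) + y * I + k)).re =
      1 / ((k : ℝ) + 1) - (x + k) / ((x + k) ^ 2 + y ^ 2) := by
    intro y k
    rw [Complex.sub_re, show ((k : ℂ) + 1) = (((k : ℝ) + 1 : ℝ) : ℂ) by push_cast; ring,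
      Complex.div_ofReal_re, Complex.one_re]
    congr 1
    rw [show (x : ℂ) + y * I + k = ((x + k : ℝ) : ℂ) + y * I by push_cast; ring, one_div,
      Complex.inv_re, Complex.normSq_apply]
    simp
    ring
  have hle := hasSum_le (fun k ↦ ?_) hA hB
  · have e : (digamma ((x : ℂ) + y₁ * I) + ↑Real.eulerMascheroniConstant).re =
        (digamma ((x : ℂ) + y₁ * I)).re + Real.eulerMascheroniConstant := by simp
    have e' : (digamma ((x : ℂ) + y₂ * I) + ↑Real.eulerMascheroniConstant).re =
        (digamma ((x : ℂ) + y₂ * I)).re + Real.eulerMascheroniConstant := by simp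
    linarith [e, e']
  · rw [hre y₁ k, hre y₂ k]
    have hxk : 0 < x + k := by positivity
    have : (x + k) / ((x + k) ^ 2 + y₂ ^ 2) ≤ (x + k) / ((x + k) ^ 2 + y₁ ^ 2) := by
      apply div_le_div_of_nonneg_left hxk.le (by positivity)
      nlinarith
    linarith

/-- `Re ψ` is even in `y`: `Re ψ(x − iy) = Re ψ(x + iy)`. [folklore] -/
theorem re_digamma_neg_im (x y : ℝ) :
    (digamma ((x : ℂ) - y * I)).re = (digamma ((x : ℂ) + y * I)).re := by
  have : ((x : ℂ) - y * I) = starRingEnd ℂ ((x : ℂ) + y * I) := by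
    apply Complex.ext <;> simp
  rw [this, digamma_conj, Complex.conj_re]

/-! ## `Re F₀` for the test function -/

/-- `Re F₀(z) = Re F(z) − η g₁ Re z/‖z‖²` for `f = ηh(η·)` (`f(0) = ηg₁`; both sides read with
Lean's `0⁻¹ = 0` at `z = 0`). [folklore] -/
theorem re_fordLaplace₀_eq {θ η : ℝ} (hθ : 0 < θ) (hθ' : θ < π / 2) (z : ℂ) :
    (fordLaplace₀ (kadiriTest θ η) z).re =
      (fordLaplace (kadiriTest θ η) z).re - η * fordSmoothW0 θ * z.re / ‖z‖ ^ 2 := by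
  unfold fordLaplace₀
  rw [Complex.sub_re, KadiriTest.map_zero hθ hθ', show ((η * fordSmoothW0 θ : ℝ) : ℂ) / z =
    ((η * fordSmoothW0 θ : ℝ) : ℂ) * z⁻¹ by rw [div_eq_mul_inv], Complex.re_ofReal_mul,
    Complex.inv_re, Complex.normSq_eq_norm_sq]
  ring

/-- **Lemma 3.2 for `F₀`**: `|Re F₀(z)| ≤ M(Re z/η) η²/‖z‖²` (`z ≠ 0`). [cite: Kadiri2005, Lemma 3.2] -/
theorem abs_re_fordLaplace₀_le {θ η : ℝ} (hθ : 0 < θ) (hθ' : θ < π / 2) (hη : 0 < η) {z : ℂ}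
    (hz : z ≠ 0) :
    |(fordLaplace₀ (kadiriTest θ η) z).re| ≤ mtyM θ (z.re / η) * η ^ 2 / ‖z‖ ^ 2 := by
  rw [re_fordLaplace₀_eq hθ hθ' z]
  exact KadiriTest.abs_re_fordLaplace_sub_le hθ hθ' hη hz

/-! ## The bound for `T₂` -/

/-- The integrand of `T₂` is integrable, with the explicit majorant
`(log(3+|y|) + 12) · M((σ−½)/η)η²/((σ−½)² + (t−y)²)` for its real part. [folklore] -/
theorem integrable_T2_majorant {a t A B : ℝ} (ha : 0 < a) (hA : 0 ≤ A) (hB : 0 ≤ B) :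
    Integrable fun y : ℝ ↦ (Real.log (3 + |y|) + A) * (B / (a ^ 2 + (t - y) ^ 2)) := by
  have hmaj := (SmoothedEF.integrable_left_majorant' (A := A + 2) (a := a) (t := t) (by linarith) ha).const_mul B
  have hc1 : Continuous fun y : ℝ ↦ Real.log (3 + |y|) + A :=
    ((continuous_const.add continuous_abs).log fun y ↦ (by positivity : (0 : ℝ) < 3 + |y|).ne').add
      continuous_const
  refine hmaj.mono' (hc1.mul (Continuous.div continuous_const (by fun_prop) fun y ↦ by
    positivity)).aestronglyMeasurable (ae_of_all _ fun y ↦ ?_)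
  have hpos : 0 < a ^ 2 + (t - y) ^ 2 := by positivity
  have hlog3 : Real.log (3 + |y|) ≤ 2 + 2 * Real.log (1 + |y|) := by
    have h1 : Real.log (3 + |y|) ≤ Real.log 3 + Real.log (1 + |y|) := by
      rw [← Real.log_mul (by norm_num) (by positivity)]
      exact Real.log_le_log (by positivity) (by nlinarith [abs_nonneg y])
    have h2 : Real.log 3 < 2 := by
      have := Real.exp_one_gt_d9
      have h : (3 : ℝ) < Real.exp 2 := by
        have e : Real.exp 2 = Real.exp 1 ^ 2 := by rw [← Real.exp_nat_mul]; norm_num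
        rw [e]; nlinarith
      calc Real.log 3 < Real.log (Real.exp 2) := Real.log_lt_log (by norm_num) h
        _ = 2 := Real.log_exp 2
    have h3 : 0 ≤ Real.log (1 + |y|) := Real.log_nonneg (by linarith [abs_nonneg y])
    linarith
  have hl0 : 0 ≤ Real.log (3 + |y|) := Real.log_nonneg (by linarith [abs_nonneg y])
  rw [Real.norm_eq_abs, abs_of_nonneg (by positivity)]
  calc (Real.log (3 + |y|) + A) * (B / (a ^ 2 + (t - y) ^ 2))
      = B * ((Real.log (3 + |y|) + A) / (a ^ 2 + (t - y) ^ 2)) := by ring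
    _ ≤ B * ((A + 2 + 2 * Real.log (1 + |y|)) / (a ^ 2 + (t - y) ^ 2)) := by
        refine mul_le_mul_of_nonneg_left (div_le_div_of_nonneg_right (by linarith) hpos.le) hB

/-- **Kadiri's Lemma 4.7 (structural form).** For `f = ηh(η·)`, `s = σ + it` with `σ > 1/2`:
`|T₂(s)| ≤ M(σ/η)η²/(σ²+t²) + (M((σ−½)/η)η²/(2π)) ∫ |Re ψ((1/2+iy)/2)| /((σ−½)² + (t−y)²) dy`,
where `T₂(s) = Re[F₀(s) + (1/2π)∫ Re ψ((1/2+iy)/2) F₀(s − 1/2 − iy) dy]` is the `Γ`-remainder of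
`SmoothedEF.re_fordK_eq_kadiri`. [cite: Kadiri2005, Lemma 4.7] -/
theorem abs_T2_le {θ η : ℝ} (hθ : 0 < θ) (hθ' : θ < π / 2) (hη : 0 < η) {σ t : ℝ} (hσ : 1 / 2 < σ) :
    |(fordLaplace₀ (kadiriTest θ η) ((σ : ℂ) + t * I) + (1 / (2 * π) : ℂ) *
        ∫ y : ℝ, ((digamma (((((1 / 2 : ℝ)) : ℂ) + y * I) / 2)).re : ℂ) *
          fordLaplace₀ (kadiriTest θ η) (((σ : ℂ) + t * I) - ((((1 / 2 : ℝ)) : ℂ) + y * I))).re| ≤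
      mtyM θ (σ / η) * η ^ 2 / (σ ^ 2 + t ^ 2) +
        mtyM θ ((σ - 1 / 2) / η) * η ^ 2 / (2 * π) *
          ∫ y : ℝ, |(digamma (((((1 / 2 : ℝ)) : ℂ) + y * I) / 2)).re| / ((σ - 1 / 2) ^ 2 + (t - y) ^ 2) := by
  set f := kadiriTest θ η with hf
  set s : ℂ := (σ : ℂ) + t * I with hs
  set a : ℝ := σ - 1 / 2 with ha
  have ha0 : 0 < a := by rw [ha]; linarith
  set Mₐ : ℝ := mtyM θ (a / η) * η ^ 2 with hMₐ
  have hMₐ0 : 0 ≤ Mₐ := by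
    have := KadiriTest.mtyM_nonneg hθ hθ' (a / η)
    positivity
  have hT := KadiriTest.isSmoothedEFTest hθ hθ' hη
  -- the integrand and its integrability
  set G : ℝ → ℂ := fun y ↦ ((digamma (((((1 / 2 : ℝ)) : ℂ) + y * I) / 2)).re : ℂ) *
    fordLaplace₀ f (s - ((((1 / 2 : ℝ)) : ℂ) + y * I)) with hG
  have hz : ∀ y : ℝ, s - ((((1 / 2 : ℝ)) : ℂ) + y * I) = ((a : ℂ) + (t - y : ℝ) * I) := by
    intro y; rw [hs, ha]; push_cast; ring
  have hz0 : ∀ y : ℝ, ((a : ℂ) + (t - y : ℝ) * I) ≠ 0 := fun y e ↦ by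
    have := congrArg Complex.re e; simp at this; linarith
  have hnorm : ∀ y : ℝ, ‖((a : ℂ) + (t - y : ℝ) * I)‖ ^ 2 = a ^ 2 + (t - y) ^ 2 := by
    intro y; rw [Complex.sq_norm, Complex.normSq_apply]; simp; ring
  -- pointwise bound for the real part of the integrand
  have hGre : ∀ y : ℝ, (G y).re =
      (digamma (((((1 / 2 : ℝ)) : ℂ) + y * I) / 2)).re * (fordLaplace₀ f ((a : ℂ) + (t - y : ℝ) * I)).re := by
    intro y
    rw [hG]
    simp only [hz y, Complex.re_ofReal_mul]
  have hbound : ∀ y : ℝ, |(G y).re| ≤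
      |(digamma (((((1 / 2 : ℝ)) : ℂ) + y * I) / 2)).re| * (Mₐ / (a ^ 2 + (t - y) ^ 2)) := by
    intro y
    rw [hGre y, abs_mul]
    refine mul_le_mul_of_nonneg_left ?_ (abs_nonneg _)
    have h := abs_re_fordLaplace₀_le hθ hθ' hη (hz0 y)
    simp only [Complex.add_re, Complex.ofReal_re, Complex.mul_re, Complex.I_re, Complex.I_im,
      Complex.ofReal_im, mul_zero, zero_mul, sub_zero, add_zero, hnorm y] at h
    rwa [hMₐ]
  have hGint : Integrable G := by
    have h1 := SmoothedEF.integrable_kadiriQ_vertical hT (s := s) (by simp [hs]; linarith)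
      (a := 1 / 2) (Or.inl rfl)
    refine h1.congr (ae_of_all _ fun y ↦ ?_)
    simp only
    rw [SmoothedEF.kadiriQ_right_line]
  have hGre_int : Integrable fun y ↦ (G y).re := hGint.re
  have hcont : Continuous fun y : ℝ ↦ digamma (((((1 / 2 : ℝ)) : ℂ) + y * I) / 2) := by
    set g : ℝ → ℂ := fun y ↦ ((((1 / 2 : ℝ)) : ℂ) + y * I) / 2 with hg
    have hgc : Continuous g := by rw [hg]; fun_prop
    have e : (fun y : ℝ ↦ digamma (((((1 / 2 : ℝ)) : ℂ) + y * I) / 2)) = digamma ∘ g := rfl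
    rw [e]
    refine continuous_iff_continuousAt.2 fun y ↦ ?_
    have hd := SmoothedEF.differentiableAt_digamma (z := g y) (by simp [hg])
    exact hd.continuousAt.comp hgc.continuousAt
  have hmaj_int : Integrable fun y : ℝ ↦
      |(digamma (((((1 / 2 : ℝ)) : ℂ) + y * I) / 2)).re| * (Mₐ / (a ^ 2 + (t - y) ^ 2)) := by
    have h := integrable_T2_majorant (t := t) ha0 (by norm_num : (0 : ℝ) ≤ 12) hMₐ0
    refine h.mono' ((continuous_abs.comp (Complex.continuous_re.comp hcont)).mul
      (Continuous.div continuous_const (by fun_prop) fun y ↦ by positivity)).aestronglyMeasurable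
      (ae_of_all _ fun y ↦ ?_)
    rw [Real.norm_eq_abs, abs_mul, abs_abs,
      abs_of_nonneg (by positivity : 0 ≤ Mₐ / (a ^ 2 + (t - y) ^ 2))]
    exact mul_le_mul_of_nonneg_right (abs_re_digamma_le y) (by positivity)
  -- the integral term
  have hI : |(∫ y, G y).re| ≤ Mₐ * ∫ y : ℝ,
      |(digamma (((((1 / 2 : ℝ)) : ℂ) + y * I) / 2)).re| / (a ^ 2 + (t - y) ^ 2) := by
    have h1 : (∫ y, G y).re = ∫ y, (G y).re := by
      have := integral_re hGint
      simpa using this.symm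
    rw [h1]
    set ψa : ℝ → ℝ := fun y ↦ |(digamma (((((1 / 2 : ℝ)) : ℂ) + y * I) / 2)).re| with hψa
    have s1 : |(∫ y, (G y).re)| ≤ ∫ y, |(G y).re| := abs_integral_le_integral_abs
    have s2 : (∫ y, |(G y).re|) ≤ ∫ y, ψa y * (Mₐ / (a ^ 2 + (t - y) ^ 2)) :=
      integral_mono hGre_int.abs hmaj_int hbound
    have s3 : (∫ y, ψa y * (Mₐ / (a ^ 2 + (t - y) ^ 2))) = Mₐ * ∫ y : ℝ, ψa y / (a ^ 2 + (t - y) ^ 2) := by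
      rw [← integral_const_mul]
      refine integral_congr_ae (ae_of_all _ fun y ↦ ?_)
      simp only
      ring
    linarith
  -- the `F₀(s)` term
  have hs0 : s ≠ 0 := fun e ↦ by have := congrArg Complex.re e; simp [hs] at this; linarith
  have hF0 : |(fordLaplace₀ f s).re| ≤ mtyM θ (σ / η) * η ^ 2 / (σ ^ 2 + t ^ 2) := by
    have h := abs_re_fordLaplace₀_le hθ hθ' hη hs0
    have hsre : s.re = σ := by simp [hs]
    have hsn : ‖s‖ ^ 2 = σ ^ 2 + t ^ 2 := by rw [Complex.sq_norm, Complex.normSq_apply]; simp [hs]; ring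
    rwa [hsre, hsn] at h
  -- assemble
  have hc : (1 / (2 * π) : ℂ) = (((1 / (2 * π) : ℝ)) : ℂ) := by push_cast; ring
  have hJ0 : 0 ≤ ∫ y : ℝ, |(digamma (((((1 / 2 : ℝ)) : ℂ) + y * I) / 2)).re| / (a ^ 2 + (t - y) ^ 2) :=
    integral_nonneg fun y ↦ by positivity
  rw [Complex.add_re, hc, Complex.re_ofReal_mul]
  have hπ : 0 < 1 / (2 * π) := by positivity
  calc |(fordLaplace₀ f s).re + 1 / (2 * π) * (∫ y, G y).re|
      ≤ |(fordLaplace₀ f s).re| + |1 / (2 * π) * (∫ y, G y).re| := abs_add_le _ _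
    _ = |(fordLaplace₀ f s).re| + 1 / (2 * π) * |(∫ y, G y).re| := by
        rw [abs_mul, abs_of_pos hπ]
    _ ≤ mtyM θ (σ / η) * η ^ 2 / (σ ^ 2 + t ^ 2) + 1 / (2 * π) * (Mₐ * ∫ y : ℝ,
          |(digamma (((((1 / 2 : ℝ)) : ℂ) + y * I) / 2)).re| / (a ^ 2 + (t - y) ^ 2)) := by
        gcongr
    _ = _ := by rw [hMₐ, ha]; ring

end KadiriGamma

end Literature.NumberTheory.LFunctions
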